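import Literature.Computability.AlgebraicComplexity.BorderRankCW

/-!
# The small Coppersmith–Winograd tensor `T_{cw,2}` over `ℂ`: an explicit torus family of rank-4 decompositions

Solo seat `solo-MatrixMultiplication-informed` (ideation tier, family 6), 2026-08-18. Door D1 of the seat's plan is
`ω = 2 ⟸ R̃(T_{cw,2}) = 3` (Coppersmith–Winograd 1990 §11; in-tree `omega_le_two_of_cw_two`); this file records the
first exact facts about `T_{cw,2} = cwTensor ℂ 2` that the plan uses.

Over `ℂ`, `T_{cw,2} = ∑_{j=1,2} (e₀⊗e_j⊗e_j + e_j⊗e₀⊗e_j + e_j⊗e_j⊗e₀)` is the symmetric tensor of the cubic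
`3·x₀(x₁² + x₂²) = 3·x₀·(x₁ + i x₂)·(x₁ − i x₂)`, a monomial in the coordinates `x₀, y = x₁ + i x₂, z = x₁ − i x₂`
(Conner–Huang–Landsberg 2022, §1: "after a change of basis `T_{cw,2}` is just a monomial written as a tensor").
From the four-cube identity `∑_{ε₂,ε₃ = ±1} ε₂ε₃ (a + ε₂ b + ε₃ c)³ = 24·abc` with `a = s₀x₀`, `b = s₁y`, `c = s₂z`
we get, for ALL `s₀ s₁ s₂ : ℂ`, the polynomial identity

  `(s₀s₁s₂) · T_{cw,2} = ∑_{ε} (ε₂ε₃/8) · ℓ_ε ⊗ ℓ_ε ⊗ ℓ_ε`,  `ℓ_ε = (s₀, ε₂s₁ + ε₃s₂, i(ε₂s₁ − ε₃s₂))` on `(x₀,x₁,x₂)`,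

(`cwTensor_two_torus_family`), hence for every point of the torus `s₀s₁s₂ = 1` a rank-4 decomposition of `T_{cw,2}`
(`cwTensor_two_eq_sum_four_triads`), so `R(T_{cw,2}) ≤ 4` (`tensorRank_cwTensor_two_le_four`) and, with the vendored
fact `bR(T_{cw,q}) = q + 2` (CGLV22 §1.2), `R(T_{cw,2}) = bR(T_{cw,2}) = 4` (`tensorRank_cwTensor_two_eq_four`).

Remark (why the family matters). The decompositions for different torus points are genuinely different (the 4-planes
`⟨ℓ_ε^{⊗3}⟩ ⊂ A⊗B⊗C` vary with `(s₀² : s₁s₂)`-data; exact check in the seat's `work/vsp_cw2/check_family.py`), so the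
variety of border-rank-4 decompositions of `T_{cw,2}` is at least 2-dimensional; the "three points" of CHL22 Thm. 1.6 are
its torus-fixed points. Positive-dimensional families of decompositions are the mechanism behind every known strict
submultiplicativity of border rank under Kronecker powers (CGLV22 §2.4), which is what door D1 needs for `T_{cw,2}^{⊠N}`.

References: A. Conner, F. Gesmundo, J. M. Landsberg, E. Ventura, comput. complexity 31 (2022), arXiv:1909.04785;
A. Conner, H. Huang, J. M. Landsberg, Found. Comput. Math. (2022), arXiv:2009.11391, §1 and Thm. 1.6/6.2;
D. Coppersmith, S. Winograd, J. Symbolic Comput. 9 (1990), §11.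
-/

noncomputable section

open scoped BigOperators
open Complex

namespace Summit.MatrixMultiplication.MatrixMultiplication.Theorems

open Literature.Computability.AlgebraicComplexity

/-- **Torus family, polynomial form.** For all `s₀ s₁ s₂ : ℂ`,
`(s₀s₁s₂)·T_{cw,2} = ∑_{ε₂,ε₃=±1} (ε₂ε₃/8)·ℓ_ε^{⊗3}` with `ℓ_ε = (s₀, ε₂s₁+ε₃s₂, i(ε₂s₁−ε₃s₂))`, the four sign
patterns `ε = (1,1),(1,−1),(−1,1),(−1,−1)` being indexed by `Fin 4` (signs `ε₂ε₃ = 1,−1,−1,1`). A polynomial identity in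
`s₀,s₁,s₂` (using only `i² = −1`). [cite: ConnerHuangLandsberg2020, §1 (T_cw,2 is a monomial)] -/
theorem cwTensor_two_torus_family (s₀ s₁ s₂ : ℂ) :
    (s₀ * s₁ * s₂) • cwTensor ℂ 2 =
      ∑ e : Fin 4,
        triad (fun a => (![1, -1, -1, 1] : Fin 4 → ℂ) e / 8 *
            (![![s₀, s₁ + s₂, I * (s₁ - s₂)], ![s₀, s₁ - s₂, I * (s₁ + s₂)],
               ![s₀, -s₁ + s₂, I * (-s₁ - s₂)], ![s₀, -s₁ - s₂, I * (-s₁ + s₂)]] : Fin 4 → Fin 3 → ℂ) e a)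
          ((![![s₀, s₁ + s₂, I * (s₁ - s₂)], ![s₀, s₁ - s₂, I * (s₁ + s₂)],
               ![s₀, -s₁ + s₂, I * (-s₁ - s₂)], ![s₀, -s₁ - s₂, I * (-s₁ + s₂)]] : Fin 4 → Fin 3 → ℂ) e)
          ((![![s₀, s₁ + s₂, I * (s₁ - s₂)], ![s₀, s₁ - s₂, I * (s₁ + s₂)],
               ![s₀, -s₁ + s₂, I * (-s₁ - s₂)], ![s₀, -s₁ - s₂, I * (-s₁ + s₂)]] : Fin 4 → Fin 3 → ℂ) e) := by
  funext a b c
  simp only [Pi.smul_apply, smul_eq_mul, Finset.sum_apply, Fin.sum_univ_four, triad_apply, cwTensor_apply]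
  fin_cases a <;> fin_cases b <;> fin_cases c <;> simp <;>
    first
      | ring1
      | linear_combination (s₀ * s₁ * s₂) * Complex.I_sq

/-- **Torus family of rank-4 decompositions.** For every point of the torus `s₀s₁s₂ = 1`, `T_{cw,2}` is the sum of the
four triads `(ε₂ε₃/8)·ℓ_ε ⊗ ℓ_ε ⊗ ℓ_ε` of `cwTensor_two_torus_family`. [cite: ConnerHuangLandsberg2020, §1 (T_cw,2 is a monomial)] -/
theorem cwTensor_two_eq_sum_four_triads (s₀ s₁ s₂ : ℂ) (hs : s₀ * s₁ * s₂ = 1) :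
    cwTensor ℂ 2 =
      ∑ e : Fin 4,
        triad (fun a => (![1, -1, -1, 1] : Fin 4 → ℂ) e / 8 *
            (![![s₀, s₁ + s₂, I * (s₁ - s₂)], ![s₀, s₁ - s₂, I * (s₁ + s₂)],
               ![s₀, -s₁ + s₂, I * (-s₁ - s₂)], ![s₀, -s₁ - s₂, I * (-s₁ + s₂)]] : Fin 4 → Fin 3 → ℂ) e a)
          ((![![s₀, s₁ + s₂, I * (s₁ - s₂)], ![s₀, s₁ - s₂, I * (s₁ + s₂)],
               ![s₀, -s₁ + s₂, I * (-s₁ - s₂)], ![s₀, -s₁ - s₂, I * (-s₁ + s₂)]] : Fin 4 → Fin 3 → ℂ) e)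
          ((![![s₀, s₁ + s₂, I * (s₁ - s₂)], ![s₀, s₁ - s₂, I * (s₁ + s₂)],
               ![s₀, -s₁ + s₂, I * (-s₁ - s₂)], ![s₀, -s₁ - s₂, I * (-s₁ + s₂)]] : Fin 4 → Fin 3 → ℂ) e) := by
  have h := cwTensor_two_torus_family s₀ s₁ s₂
  rwa [hs, one_smul] at h

/-- **`R(T_{cw,2}) ≤ 4` over `ℂ`** (the torus point `s = (1,1,1)`). [cite: ConnerHuangLandsberg2020, §1 (T_cw,2 is a monomial)] -/
theorem tensorRank_cwTensor_two_le_four : tensorRank (cwTensor ℂ 2) ≤ 4 :=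
  tensorRank_le_of_eq_sum _ _ _ (cwTensor_two_eq_sum_four_triads 1 1 1 (by norm_num))

/-- **`R(T_{cw,2}) = 4` over `ℂ`**, given the vendored fact `bR(T_{cw,q}) = q + 2` for `q ≥ 2`
(CGLV22 §1.2): `4 = bR ≤ R ≤ 4`. [cite: ConnerGesmundoLandsbergVentura2022, §1.2] -/
theorem tensorRank_cwTensor_two_eq_four (h : CGLV2022_borderRank_cwTensor) : tensorRank (cwTensor ℂ 2) = 4 := by
  refine le_antisymm tensorRank_cwTensor_two_le_four ?_
  have h4 : algBorderRank (cwTensor ℂ 2) = 2 + 2 := h 2 le_rfl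
  have hle := algBorderRank_le_tensorRank (cwTensor ℂ 2)
  omega

end Summit.MatrixMultiplication.MatrixMultiplication.Theorems

end
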